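import Summits.QuantumFields.YangMills.Theorems.UnitScaleTiltFluctuationComparisonRegPrLiftFaceCert

/-!
# Route `UnitScaleTilt` — crux K1bR-pr `FluctuationComparisonRegPr` (stmt-QuantumFields-19201), stub `stub_oneStepSmallLift`
# (W7 line), piece (L2), layer F8a′: RESTRICTING A KEYED FUNCTIONAL TO ITS SUPPORT (support file `--supports stmt-QuantumFields-19201`)

Fleet seat `ym-ust-19201-p1` gen 2.  The certificate data files evaluate `keyedMass` (layer F8a, `…LiftFaceCert`) by kernel computation; over the
full index type `RowIdx ⊕ ChainIdx` (≈ 3.5k indices, almost all with coefficient `0`) the fibrewise evaluation is quadratic and too slow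
(≈ 20 s per fine-plaquette class at `L = 3`).  This file proves that the fibrewise mass may be computed on the SUPPORT of the coefficients
(`keyedMass_restrict`), which has ≈ 10² elements per class.  Elementary.
-/

noncomputable section

open scoped BigOperators

namespace Summit.QuantumFields.YangMills.Theorems.ApproxLift

open Literature.MathematicalPhysics.QuantumFieldTheory.Balaban1983to89

variable {P : Params}

/-- **RESTRICTION TO THE SUPPORT**: indices with coefficient `0` contribute to no fibre, so the fibrewise mass of `(c, key)` equals that of its
restriction to `{i // c i ≠ 0}`. -/
theorem keyedMass_restrict {ι : Type*} [Fintype ι] (c : ι → ℝ) (key : ι → Key P.d) [DecidablePred fun i => c i ≠ 0] :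
    keyedMass c key = keyedMass (fun i : {i // c i ≠ 0} => c i.1) (fun i => key i.1) := by
  classical
  unfold keyedMass
  -- the fibre sums agree
  have hFG : ∀ k : Key P.d, ∑ i ∈ Finset.univ.filter (fun i => key i = k), c i =
      ∑ j ∈ (Finset.univ : Finset {i // c i ≠ 0}).filter (fun j => key j.1 = k), c j.1 := by
    intro k
    rw [Finset.sum_filter, Finset.sum_filter]
    rw [← Finset.sum_subtype (s := Finset.univ.filter fun i => c i ≠ 0) (p := fun i => c i ≠ 0)
      (fun i => by simp) (f := fun i => if key i = k then c i else 0)]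
    rw [Finset.sum_filter]
    refine Finset.sum_congr rfl fun i _ => ?_
    by_cases h1 : key i = k <;> by_cases h2 : c i ≠ 0 <;> simp [h1, h2]
    · exact not_not.mp h2
  -- keys outside the image of the support carry the fibre sum `0`
  have hsub : (Finset.univ : Finset {i // c i ≠ 0}).image (fun j => key j.1) ⊆ Finset.univ.image key := by
    intro k hk
    obtain ⟨j, _, rfl⟩ := Finset.mem_image.mp hk
    exact Finset.mem_image_of_mem key (Finset.mem_univ _)
  rw [← Finset.sum_subset hsub]
  · exact Finset.sum_congr rfl fun k _ => by rw [hFG k]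
  · intro k _ hk
    rw [hFG k, abs_eq_zero]
    refine Finset.sum_eq_zero fun j hj => ?_
    exfalso
    exact hk (Finset.mem_image.mpr ⟨j, Finset.mem_univ _, (Finset.mem_filter.mp hj).2⟩)

end Summit.QuantumFields.YangMills.Theorems.ApproxLift

end
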